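import Mathlib
import HarnessLib

/-!
# Orthogonal matrices act on `ℝ³` by linear isometries, multiplicatively

Mathlib only; no named facts.

The compact group `O(3) = Matrix.unitaryGroup (Fin 3) ℝ` acts on `E3 = EuclideanSpace ℝ (Fin 3)`
by `x ↦ A x`.  We package this action as a monoid homomorphism `Φ : O(3) →* (E3 ≃ₗᵢ[ℝ] E3)` into
the group of linear isometric automorphisms of `E3` (Mathlib's group structure on `E ≃ₗᵢ[ℝ] E`,
`(e * e') x = e (e' x)`), together with the action formula `Φ A x = A x` (matrix times vector).

Construction: `Matrix.toEuclideanCLM` is a star-algebra isomorphism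
`Matrix (Fin 3) (Fin 3) ℝ ≃⋆ₐ[ℝ] (E3 →L[ℝ] E3)`, hence restricts to a monoid homomorphism between
the unitary subgroups (`Unitary.map`), and the unitary continuous linear endomorphisms of a
Hilbert space are exactly its linear isometric automorphisms (`Unitary.linearIsometryEquiv`, a
group isomorphism).  The action formula then holds by `rfl`.

This is the registered stub `exists_unitaryGroup_toLIE` of the refutation skeleton of the crux
`OddMorawetzLocal`.
-/

noncomputable section

set_option linter.dupNamespace false

namespace Summit.NavierStokesRegularity.NavierStokesRegularity.Theorems

/-- **`O(3)` acts on `ℝ³` by linear isometries, multiplicatively.**  There is a monoid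
homomorphism `Φ` from the orthogonal group `Matrix.unitaryGroup (Fin 3) ℝ` to the group of linear
isometric automorphisms of `EuclideanSpace ℝ (Fin 3)` such that `Φ A` is `x ↦ A x` for every
orthogonal matrix `A`. -/
theorem exists_unitaryGroup_toLIE :
    ∃ Φ : Matrix.unitaryGroup (Fin 3) ℝ →* (EuclideanSpace ℝ (Fin 3) ≃ₗᵢ[ℝ] EuclideanSpace ℝ (Fin 3)),
      ∀ (A : Matrix.unitaryGroup (Fin 3) ℝ) (x : EuclideanSpace ℝ (Fin 3)),
        Φ A x = WithLp.toLp 2 ((A : Matrix (Fin 3) (Fin 3) ℝ).mulVec (WithLp.ofLp x)) := by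
  -- matrices `≃⋆ₐ` continuous linear endomorphisms of `E3`, as a star monoid homomorphism
  let f : Matrix (Fin 3) (Fin 3) ℝ →⋆* (EuclideanSpace ℝ (Fin 3) →L[ℝ] EuclideanSpace ℝ (Fin 3)) :=
    { toFun := Matrix.toEuclideanCLM (n := Fin 3) (𝕜 := ℝ)
      map_one' := map_one _
      map_mul' := map_mul _
      map_star' := map_star _ }
  -- restrict to unitaries, then identify unitary endomorphisms with linear isometric automorphisms
  exact ⟨Unitary.linearIsometryEquiv.toMonoidHom.comp (Unitary.map f).toMonoidHom, fun A x => rfl⟩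

end Summit.NavierStokesRegularity.NavierStokesRegularity.Theorems
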